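import Literature.Barriers.ValiantsHypothesis.BIJL18Thm4StrengthenedPipeline
import Literature.Barriers.ValiantsHypothesis.BIJL18BorderCompletionRankProofs
import HarnessLib

/-!
# Bläser–Ikenmeyer–Jindal–Lysikov 2018, Obs. 17 / Thm 4 strengthened — a CERTIFICATE OF VACUITY:
# tensors with zero slices lie in the Zariski closure of the image of `g_c`; the varieties
# `C^{n,t,c}_r` need not be Zariski closed; the typed fact `BIJL2018_thm4_strengthened` is inhabited
# by degenerate witnesses

ERRATUM-class companion (val-lit t23 g7 self-audit of its own roster; kernel-checked record for the registry)
of `BIJL18MatrixCompletion.lean` (`bijlVariety`, `lemma16VanishingIdeal`, the typed fact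
`BIJL2018_thm4_strengthened`) and `BIJL18Thm4StrengthenedOfPIT.lean` (its by-name discharge
`BIJL2018_thm4_strengthened_holds`, an honest instantiation of the printed `∃BPP` argument).

The print (ECCC TR18-064 p. 12, Obs. 17): "We can think of `g` constructed in Lemma 16 as a polynomial map …
The closure of the image of `g` is `C^{n,t,c}_r`. Therefore, `C^{n,t,c}_r` itself is irreducible. We can
strengthen the statement of Theorem 4: There are infinite sequences `t_n = Θ(n)` and `r_n = Θ(n)` and a constant
`c` such that for every set of equations describing the variety `C^{n,t_n,c}_{r_n}`, at least one equation has
superpolynomial circuit complexity, unless `coNP ⊆ ∃BPP`." With the paper's OWN Def. 9 (rank-RESTRICTED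
approximations `Ã_i ∈ K(ε)^{n×n}_{rk A_i}`, typed literally in the tree) the closure sentence is false in general:

* §1 **`eval_eq_zero_of_free_slices`** (every infinite field `K`, all `n t c r`): a tensor `(A₀; A)` whose
  slices have rank `≤ c` and whose slice-free slots `F` (those with `A_k = 0`) carry a decomposition
  `A₀ = Σ_{k∈F} U_kᵀ V_k` with `U_k, V_k ∈ K^{c×n}` lies in `Z(I(im g_c))` FOR EVERY `r` — explicit rational
  curve `U₀ = V₀ = 0`, used slices factored exactly (Obs. 15), free slices `ε·U_kᵀ V_k` with `z_k = −1/ε`: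
  `g_c(curve(ε)) = T + ε·W` is polynomial in `ε`, so every `p` with `p ∘ g_c = 0` has `p(T) = 0`
  (`Polynomial.eq_zero_of_infinite_isRoot`). Such `T` may have border completion rank `> r`.
* §2 the smallest instance, `n = 1`, `t = 2`, `c ≥ 1`, `r = 0`, `T = ((1); 0, 0)`:
  `example_not_mem_bijlVariety` (`\underline{CR}(T) ≥ 1 > 0`, so `T ∉ C^{1,2,c}_0`) and
  **`not_exists_equations_example`**: NO set `S` of polynomials has zero set `bijlVariety K 1 2 c 0`
  (`C^{1,2,c}_0` is not Zariski closed — correction to Obs. 17's closure sentence under Def. 9).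
* §3 **`BIJL2018_thm4_strengthened_of_degenerate_witnesses`**: consequently the TYPED fact
  `BIJL2018_thm4_strengthened K` (whose hypothesis "zero set of `S n` = `C^{n,t n,c}_{r n}` for ALL `n`" sits under
  ∃-chosen `t, r, c`) is inhabited by the degenerate witnesses `t n = n + 1`, `r n = 13⌊n/20⌋` (`= 0` at `n = 1`),
  `c = 1`: the hypothesis fails at `n = 1`, so the implication is vacuous. The typed statement is therefore
  "true for the wrong reason" as well as for the printed one; a faithful, non-vacuous typing of the remark needs
  (i) the paper's no-spare-slot tensor family (every slice nonzero) instead of the tree's `2s + 1`-slot coding and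
  (ii) a Lemma-14 for rank-UNRESTRICTED approximations (the printed Lemma 13 uses `rk Ã_k = rk A_k`) — neither is
  in print; no corrected fact is minted here (its truth under the closure reading is not established).

* §4 (v2, the ALL-`n` certificate; val-lit ref-3 np 1368 / registry A44 sharpening) **`borderCompletionRank_one_zero`**:
  `\underline{CR}(I_n; 0, …, 0) = n` for every `n, t` (Def. 9: the rank-`0` approximations of the zero slices vanish,
  so the pencil is `Ã₀ = I_n + O(ε)`, `det Ã₀ = 1 + O(ε) ≠ 0`); **`eval_eq_zero_one_zero`**: for `n ≤ c·t` the tensor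
  `(I_n; 0, …, 0)` lies in `Z(I(im g_c))` for EVERY `r` (`I_n = Σ_{k<t} E_kᵀ E_k` with the `c × n` block selectors
  `E_k`, all `t` slots free); hence **`not_exists_equations_of_lt`**: for ALL `n t c r` with `r < n ≤ c·t` NO set of
  polynomials has zero set `bijlVariety K n t c r` (every infinite field, algebraically closed ones included — so the
  sentence "it holds over algebraically closed `K`" in the module docstring of `BIJL18Obs17ClosureProofs.lean` about the
  converse inclusion `\overline{im g} ⊆ C^{n,t,c}_r` is NOT correct either: the converse fails whenever `r < n ≤ c·t`);
  **`hypothesis_unsatisfiable`**: the typed `∀ n`-hypothesis of `BIJL2018_thm4_strengthened` is unsatisfiable for every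
  parameter choice `(t, r, c)` admitting one `n` with `r n < n ≤ c · t n` — in particular (`not_exists_equations_tSeq_rSeq`)
  for the witnesses `t n = n + 1`, `r n = 13⌊n/20⌋`, `c = 20(B + 1)` of the genuine discharge at EVERY `n ≥ 1`.
* §5 **`BIJL2018_thm4_strengthened_vacuous`** (top namespace, sibling of `BIJL2018_thm4_strengthened_holds`): the
  ruling-named VACUITY CERTIFICATE (val-lit lead-np RULING (109)(c)(iii)) — for the discharge's own parameter shape NO
  family `S` satisfies the typed `∀ n`-hypothesis (the `∀ S` ranges over the empty family; the inhabitant-by-vacuity of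
  the Prop itself is §3's `BIJL2018_thm4_strengthened_of_degenerate_witnesses` — a second inhabitant with the type of
  `BIJL2018_thm4_strengthened_holds` would be a restatement and is not filed).

Theorem-only file, no definitions, no new fact. HONEST FRAMING (val-lit): bookkeeping on a 2018 CONDITIONAL barrier
remark about the varieties `C^{n,t,c}_r`; it says nothing about `VP`; `VP ≠ VNP` is NOT proved.

## References

* [BlaserIkenmeyerJindalLysikov2018] M. Bläser, C. Ikenmeyer, G. Jindal, V. Lysikov, *Generalized matrix
  completion and algebraic natural proofs*, STOC 2018 / ECCC TR18-064: Def. 9 (p. 8), Obs. 15, Lemma 16, Obs. 17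
  and the remark after it (p. 12), Lemma 13 (p. 9, the rank hypothesis in the normalisation).
-/

noncomputable section

open MvPolynomial

namespace Literature.Barriers.ValiantsHypothesis

universe u

namespace BIJL2018Thm4S

open Literature.Computability.AlgebraicComplexity

variable (K : Type u) [Field K]

/-! ### §1. Tensors with free (zero) slices lie in the Zariski closure of the image of `g_c` -/

/-- **The value of the Lemma-16 map on the explicit curve**: with `U₀ = V₀ = 0`, used slices factored as
`U_kᵀ V_k = A_k`, free slices `(ε U_k)ᵀ V_k` and `z_k = −ε⁻¹` on the free slots (`0` elsewhere), `g_c` takes the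
value `(Σ_{k∈F} U_kᵀ V_k ; used: A_k, free: ε · U_kᵀ V_k)` for `ε ≠ 0`.
[cite: BlaserIkenmeyerJindalLysikov2018, Lemma 16 and Obs. 17] -/
theorem lemma16Map_curve {n t c r : ℕ} (A : Fin t → Matrix (Fin n) (Fin n) K)
    (U V : Fin t → Matrix (Fin c) (Fin n) K) (F : Finset (Fin t))
    (hused : ∀ k, k ∉ F → (U k).transpose * V k = A k) {ε : K} (hε : ε ≠ 0) :
    lemma16Map K r (fun _ => c) (0 : Matrix (Fin r) (Fin n) K) 0
        (fun k => if k ∈ F then ε • U k else U k) V (fun k => if k ∈ F then -ε⁻¹ else 0) =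
      (∑ k ∈ F, (U k).transpose * V k,
        fun k => if k ∈ F then ε • ((U k).transpose * V k) else A k) := by
  classical
  have hsl : ∀ k, (if k ∈ F then ε • U k else U k).transpose * V k =
      if k ∈ F then ε • ((U k).transpose * V k) else A k := by
    intro k
    by_cases hk : k ∈ F
    · rw [if_pos hk, if_pos hk, Matrix.transpose_smul, Matrix.smul_mul]
    · rw [if_neg hk, if_neg hk, hused k hk]
  unfold lemma16Map
  refine Prod.ext ?_ (funext hsl)
  simp only
  rw [Matrix.transpose_zero, Matrix.zero_mul, zero_sub, ← Finset.sum_neg_distrib]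
  rw [← Finset.sum_filter_add_sum_filter_not Finset.univ (· ∈ F)]
  have h1 : ∑ k ∈ Finset.univ.filter (· ∈ F),
      -((if k ∈ F then -ε⁻¹ else (0 : K)) • ((if k ∈ F then ε • U k else U k).transpose * V k)) =
      ∑ k ∈ F, (U k).transpose * V k := by
    rw [Finset.filter_mem_eq_inter, Finset.univ_inter]
    refine Finset.sum_congr rfl fun k hk => ?_
    rw [if_pos hk, if_pos hk, Matrix.transpose_smul, Matrix.smul_mul, smul_smul, neg_mul,
      inv_mul_cancel₀ hε, neg_smul, one_smul, neg_neg]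
  have h2 : ∑ k ∈ Finset.univ.filter (fun k => ¬ k ∈ F),
      -((if k ∈ F then -ε⁻¹ else (0 : K)) • ((if k ∈ F then ε • U k else U k).transpose * V k)) = 0 := by
    refine Finset.sum_eq_zero fun k hk => ?_
    rw [Finset.mem_filter] at hk
    rw [if_neg hk.2, zero_smul, neg_zero]
  rw [h1, h2, add_zero]

/-- **Tensors with free slices are in the Zariski closure of `im g_c`** (every infinite field, every `r`): if the
slices of `(A₀; A)` factor through `K^{c×n}` (`A_k = U_kᵀ V_k` off `F`), the slots `k ∈ F` are free (`A_k = 0`) and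
carry `A₀ = Σ_{k∈F} U_kᵀ V_k`, then every polynomial vanishing on the image of `g_c` vanishes at `(A₀; A)` — the
curve of `lemma16Map_curve` is polynomial in `ε` with value `(A₀; A)` at `ε = 0`.
[cite: BlaserIkenmeyerJindalLysikov2018, Obs. 17 ("The closure of the image of g is C^{n,t,c}_r" — examined)] -/
theorem eval_eq_zero_of_free_slices [Infinite K] {n t c r : ℕ} (A₀ : Matrix (Fin n) (Fin n) K)
    (A : Fin t → Matrix (Fin n) (Fin n) K) (U V : Fin t → Matrix (Fin c) (Fin n) K) (F : Finset (Fin t))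
    (hused : ∀ k, k ∉ F → (U k).transpose * V k = A k) (hfree : ∀ k ∈ F, A k = 0)
    (hsum : ∑ k ∈ F, (U k).transpose * V k = A₀)
    {p : MvPolynomial (Option (Fin t) × Fin n × Fin n) K} (hp : p ∈ lemma16VanishingIdeal K n t c r) :
    eval (tensorPoint K A₀ A) p = 0 := by
  classical
  -- the direction `W` of the curve: zero constant slice, `U_kᵀ V_k` on the free slots
  set W : Option (Fin t) × Fin n × Fin n → K :=
    tensorPoint K (0 : Matrix (Fin n) (Fin n) K) (fun k => if k ∈ F then (U k).transpose * V k else 0) with hW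
  -- the univariate polynomial `Q(ε) = p(T + ε W)`
  set Q : Polynomial K :=
    MvPolynomial.aeval (fun v => Polynomial.C (tensorPoint K A₀ A v) + Polynomial.X * Polynomial.C (W v)) p with hQ
  have hQeval : ∀ ε : K, Q.eval ε = eval (fun v => tensorPoint K A₀ A v + ε * W v) p := by
    intro ε
    rw [hQ, ← Polynomial.coe_aeval_eq_eval, ← AlgHom.comp_apply, MvPolynomial.comp_aeval]
    change MvPolynomial.eval (fun i => (Polynomial.aeval ε)
      (Polynomial.C (tensorPoint K A₀ A i) + Polynomial.X * Polynomial.C (W i))) p = _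
    have hf : (fun i => (Polynomial.aeval ε) (Polynomial.C (tensorPoint K A₀ A i) + Polynomial.X * Polynomial.C (W i))) =
        fun v => tensorPoint K A₀ A v + ε * W v := by
      funext v
      rw [map_add, map_mul, Polynomial.aeval_C, Polynomial.aeval_X, Polynomial.aeval_C]
      simp only [Algebra.algebraMap_self, RingHom.id_apply]
    rw [hf]
  -- the point `T + ε W` is the value of `g_c` on the curve
  have hpt : ∀ ε : K, (fun v => tensorPoint K A₀ A v + ε * W v) =
      tensorPoint K A₀ (fun k => if k ∈ F then ε • ((U k).transpose * V k) else A k) := by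
    intro ε
    funext v
    rcases v with ⟨_ | k, i, j⟩
    · simp [tensorPoint, hW]
    · by_cases hk : k ∈ F
      · simp [tensorPoint, hW, hk, hfree k hk, Matrix.smul_apply]
      · simp [tensorPoint, hW, hk]
  -- for `ε ≠ 0`, `p` vanishes there
  have hroot : ∀ ε : K, ε ≠ 0 → Q.IsRoot ε := by
    intro ε hε
    rw [Polynomial.IsRoot, hQeval, hpt ε]
    have hg := hp (0 : Matrix (Fin r) (Fin n) K) 0 (fun k => if k ∈ F then ε • U k else U k) V
      (fun k => if k ∈ F then -ε⁻¹ else 0)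
    rw [lemma16Map_curve K A U V F hused hε, hsum] at hg
    exact hg
  have hQ0 : Q = 0 := by
    refine Polynomial.eq_zero_of_infinite_isRoot Q (Set.Infinite.mono (fun ε hε => hroot ε hε) ?_)
    exact (Set.finite_singleton (0 : K)).infinite_compl
  have h0 := hQeval 0
  rw [hQ0, Polynomial.eval_zero] at h0
  simpa using h0.symm

/-! ### §2. The smallest instance: `C^{1,2,c}_0` is not Zariski closed -/

/-- A `1 × 1` matrix over a field of rank `≤ 0` is zero (its entry is a non-vanishing `1 × 1` minor otherwise).
[folklore] -/
private theorem apply_eq_zero_of_rank_le_zero {L : Type*} [Field L] (M : Matrix (Fin 1) (Fin 1) L)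
    (h : M.rank ≤ 0) : M 0 0 = 0 := by
  by_contra hne
  have h1 := Literature.LinearAlgebra.Matrix.card_le_rank_of_det_submatrix_ne_zero M
    (fun _ : Fin 1 => (0 : Fin 1)) (fun _ => (0 : Fin 1)) (by rw [Matrix.det_unique]; simpa using hne)
  simp at h1
  omega

/-- **`\underline{CR}((1); 0, 0) ≥ 1`**: under Def. 9 the approximations of the two zero slices have rank `≤ 0`,
so the pencil is the approximation `B₀ = 1 + O(ε) ≠ 0` of the constant slice. Hence `T = ((1); 0, 0)` is NOT in
`C^{1,2,c}_0`. [cite: BlaserIkenmeyerJindalLysikov2018, Def. 9 and Obs. 17] -/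
theorem example_not_mem_bijlVariety (c : ℕ) :
    ((1 : Matrix (Fin 1) (Fin 1) K), (fun _ : Fin 2 => (0 : Matrix (Fin 1) (Fin 1) K))) ∉ bijlVariety K 1 2 c 0 := by
  classical
  rintro ⟨hle, -⟩
  obtain ⟨B₀, B, cc, hw⟩ := exists_isBorderWitness_borderCompletionRank (K := K)
    (1 : Matrix (Fin 1) (Fin 1) K) (fun _ : Fin 2 => (0 : Matrix (Fin 1) (Fin 1) K))
  have h0 : borderCompletionRank (1 : Matrix (Fin 1) (Fin 1) K)
      (fun _ : Fin 2 => (0 : Matrix (Fin 1) (Fin 1) K)) = 0 := Nat.le_zero.1 hle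
  rw [h0] at hw
  obtain ⟨hA₀, -, -, hBk, hpencil⟩ := hw
  -- the approximations of the zero slices vanish
  have hB : ∀ k, B k 0 0 = 0 := fun k =>
    apply_eq_zero_of_rank_le_zero (B k) (by simpa using hBk k)
  -- so the pencil is `B₀`, whose entry is `0` by the rank bound
  have hp0 : (pencilEval B₀ B cc) 0 0 = B₀ 0 0 := by
    simp [pencilEval, Matrix.add_apply, Matrix.smul_apply, hB]
  have hB₀ : B₀ 0 0 = 0 := by
    rw [← hp0]
    exact apply_eq_zero_of_rank_le_zero _ hpencil
  -- but `B₀ 0 0 = 1 + O(ε)`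
  have h1 : IsApproxOf ((1 : Matrix (Fin 1) (Fin 1) K) 0 0) (B₀ 0 0) := hA₀ 0 0
  rw [hB₀, Matrix.one_apply_eq] at h1
  exact one_ne_zero (IsApproxOf.eq_zero_of_zero h1)

/-- **`C^{1,2,c}_0` is NOT the zero set of any set of polynomials** (`c ≥ 1`, every infinite field): a set `S`
with zero set `bijlVariety K 1 2 c 0` would vanish on the image of `g_c`, hence (free slices, §1) at
`T = ((1); 0, 0)`, which lies outside — correction to "The closure of the image of `g` is `C^{n,t,c}_r`" under
Def. 9's rank-restricted approximations. [cite: BlaserIkenmeyerJindalLysikov2018, Obs. 17 (ECCC p. 12)] -/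
theorem not_exists_equations_example [Infinite K] {c : ℕ} (hc : 1 ≤ c) :
    ¬ ∃ S : Set (MvPolynomial (Option (Fin 2) × Fin 1 × Fin 1) K),
      {A | ∀ q ∈ S, eval (tensorPoint K A.1 A.2) q = 0} = bijlVariety K 1 2 c 0 := by
  classical
  rintro ⟨S, hS⟩
  apply example_not_mem_bijlVariety K c
  rw [← hS]
  intro q hq
  -- `q` vanishes on `C^{1,2,c}_0 ⊇ im g_c`, hence lies in the vanishing ideal of the image
  have hvan : q ∈ lemma16VanishingIdeal K 1 2 c 0 := by
    intro U₀ V₀ U V z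
    have hmem := lemma16Map_mem_bijlVariety (K := K) (n := 1) (t := 2) (c := c) (r := 0) U₀ V₀ U V z
    rw [← hS] at hmem
    exact hmem q hq
  -- the free-slice curve: slot `0` carries `A₀ = 1 = e₀ᵀ e₀` with `e₀ ∈ K^{c×1}` the first basis row
  let e : Matrix (Fin c) (Fin 1) K := fun a _ => if a = ⟨0, hc⟩ then 1 else 0
  have he : e.transpose * e = (1 : Matrix (Fin 1) (Fin 1) K) := by
    ext i j
    fin_cases i; fin_cases j
    simp only [Matrix.mul_apply, Matrix.transpose_apply, Matrix.one_apply_eq, e]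
    rw [Finset.sum_eq_single ⟨0, hc⟩ (fun a _ ha => by simp [ha]) (by simp)]
    simp
  refine eval_eq_zero_of_free_slices K (r := 0) (1 : Matrix (Fin 1) (Fin 1) K) (fun _ => 0)
    (fun k => if k = 0 then e else 0) (fun k => if k = 0 then e else 0) {0} (fun k hk => ?_) (fun _ _ => rfl) ?_ hvan
  · have hk' : k ≠ 0 := by simpa using hk
    simp [hk']
  · simp [he]

/-! ### §3. The typed fact is inhabited by degenerate witnesses -/

/-- **CERTIFICATE OF VACUITY for the typed `BIJL2018_thm4_strengthened`.** With the witnesses `t n = n + 1`,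
`r n = 13 ⌊n/20⌋` (so `r 1 = 0`), `c = 1`, `a = 4`, `b = 2`, `n₁ = 40`, the hypothesis "zero set of `S n` =
`C^{n,n+1,1}_{r n}` for every `n`" fails at `n = 1` (§2), so the typed implication holds for every `S` WITHOUT any
complexity-theoretic content. Recorded next to the honest discharge `BIJL2018_thm4_strengthened_holds` to make
the typing defect kernel-visible (the typed `∀ n`-hypothesis under ∃-chosen parameters is satisfiable-or-not at
the prover's discretion). [cite: BlaserIkenmeyerJindalLysikov2018, §3 remark after Obs. 17 (ECCC p. 12)] -/
theorem BIJL2018_thm4_strengthened_of_degenerate_witnesses [Infinite K] : BIJL2018_thm4_strengthened K := by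
  intro _
  refine ⟨tSeq, rSeq, 1, 4, 2, 40, fun n hn => growth_tSeq_rSeq n hn, fun S hS k n₀ => ?_⟩
  exact absurd ⟨S 1, hS 1⟩ (not_exists_equations_example K le_rfl)

/-! ### §4. The all-`n` certificate: `C^{n,t,c}_r` is not Zariski closed whenever `r < n ≤ c·t` -/

/-- A matrix over a field of rank `≤ 0` is zero (a nonzero entry is a non-vanishing `1 × 1` minor). [folklore] -/
private theorem eq_zero_of_rank_le_zero {L : Type*} [Field L] {m n : ℕ} (M : Matrix (Fin m) (Fin n) L)
    (h : M.rank ≤ 0) : M = 0 := by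
  ext i j
  by_contra hne
  have h1 := Literature.LinearAlgebra.Matrix.card_le_rank_of_det_submatrix_ne_zero M
    (fun _ : Fin 1 => i) (fun _ => j) (by rw [Matrix.det_unique]; simpa using hne)
  simp at h1
  omega

/-- **`\underline{CR}(I_n; 0, …, 0) = n`** (every field, every number `t` of zero slices): in a Def. 9 witness the
approximations `Ã_k` of the zero slices have rank `≤ rk A_k = 0`, so they vanish and the pencil is `Ã₀ = I_n + O(ε)`,
whose determinant `1 + O(ε)` is nonzero in `K(ε)`; conversely `\underline{CR} ≤ CR ≤ n`.
[cite: BlaserIkenmeyerJindalLysikov2018, Def. 9 (rank-restricted approximations `Ã_i ∈ K(ε)^{n×n}_{rk A_i}`), ECCC p. 8] -/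
theorem borderCompletionRank_one_zero (n t : ℕ) :
    borderCompletionRank (1 : Matrix (Fin n) (Fin n) K) (fun _ : Fin t => (0 : Matrix (Fin n) (Fin n) K)) = n := by
  classical
  refine le_antisymm ?_ ?_
  · refine (borderCompletionRank_le_completionRank _ _).trans ?_
    simpa using completionRank_le_card (1 : Matrix (Fin n) (Fin n) K)
      (fun _ : Fin t => (0 : Matrix (Fin n) (Fin n) K))
  · obtain ⟨B₀, B, cc, hA₀, -, -, hBk, hpencil⟩ := exists_isBorderWitness_borderCompletionRank (K := K)
      (1 : Matrix (Fin n) (Fin n) K) (fun _ : Fin t => (0 : Matrix (Fin n) (Fin n) K))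
    -- the approximations of the zero slices vanish, so the pencil is `B₀`
    have hB : ∀ k, B k = 0 := fun k => eq_zero_of_rank_le_zero (B k) (by simpa using hBk k)
    have hp : pencilEval B₀ B cc = B₀ := by simp [pencilEval, hB]
    rw [hp] at hpencil
    -- `det B₀ = 1 + O(ε) ≠ 0`, so `B₀` has full rank
    have hdet : B₀.det ≠ 0 := by
      intro h0
      have h1 : IsApproxOf ((1 : Matrix (Fin n) (Fin n) K).det) B₀.det := IsMatrixApproxOf.det hA₀
      rw [h0, Matrix.det_one] at h1
      exact one_ne_zero (IsApproxOf.eq_zero_of_zero h1)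
    have hn : Fintype.card (Fin n) ≤ B₀.rank :=
      Literature.LinearAlgebra.Matrix.card_le_rank_of_det_submatrix_ne_zero B₀ id id
        (by rwa [Matrix.submatrix_id_id])
    rw [Fintype.card_fin] at hn
    exact hn.trans hpencil

/-- Hence `(I_n; 0, …, 0) ∉ C^{n,t,c}_r` whenever `r < n`. [cite: BlaserIkenmeyerJindalLysikov2018, Def. 9 and Obs. 17] -/
theorem one_zero_not_mem_bijlVariety {n t c r : ℕ} (hr : r < n) :
    ((1 : Matrix (Fin n) (Fin n) K), fun _ : Fin t => (0 : Matrix (Fin n) (Fin n) K)) ∉ bijlVariety K n t c r := by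
  rintro ⟨hle, -⟩
  have h := borderCompletionRank_one_zero K n t
  simp only at hle
  omega

/-- **Block decomposition of the identity**: for `n ≤ c·t` there are `E_0, …, E_{t−1} ∈ K^{c×n}` (the selectors of
the coordinate blocks `{c k, …, c k + c − 1}`) with `Σ_k E_kᵀ E_k = I_n`. [folklore] -/
private theorem exists_sum_transpose_mul_eq_one {n t c : ℕ} (hct : n ≤ c * t) :
    ∃ E : Fin t → Matrix (Fin c) (Fin n) K, ∑ k, (E k).transpose * E k = 1 := by
  classical
  refine ⟨fun k => Matrix.of fun a j => if (j : ℕ) = c * k + a then (1 : K) else 0, ?_⟩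
  ext i j
  have hc : 0 < c := by
    rcases Nat.eq_zero_or_pos c with h | h
    · subst h; have := i.2; omega
    · exact h
  have hi : (i : ℕ) / c < t := (Nat.div_lt_iff_lt_mul hc).2 (by have := i.2; rw [Nat.mul_comm]; omega)
  rw [Matrix.sum_apply]
  simp only [Matrix.mul_apply, Matrix.transpose_apply, Matrix.of_apply, mul_ite, mul_one, mul_zero]
  -- only the block `k = i / c` and the offset `a = i % c` contribute
  rw [Finset.sum_eq_single (⟨(i : ℕ) / c, hi⟩ : Fin t) ?_ (fun h => absurd (Finset.mem_univ _) h),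
    Finset.sum_eq_single (⟨(i : ℕ) % c, Nat.mod_lt _ hc⟩ : Fin c) ?_ (fun h => absurd (Finset.mem_univ _) h)]
  · have hii : (i : ℕ) = c * ((i : ℕ) / c) + (i : ℕ) % c := (Nat.div_add_mod (i : ℕ) c).symm
    simp only [← hii, if_true]
    by_cases hij : i = j
    · subst hij; simp
    · rw [Matrix.one_apply_ne hij, if_neg (fun h => hij (Fin.ext h.symm))]
  · intro a _ ha
    have hne : (i : ℕ) ≠ c * ((i : ℕ) / c) + a := by
      intro h
      apply ha
      apply Fin.ext
      have := Nat.div_add_mod (i : ℕ) c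
      simp only
      omega
    rw [if_neg hne, ite_self]
  · intro k _ hk
    refine Finset.sum_eq_zero fun a _ => ?_
    have hne : (i : ℕ) ≠ c * (k : ℕ) + a := by
      intro h
      apply hk
      apply Fin.ext
      simp only
      rw [h, Nat.mul_add_div hc, Nat.div_eq_of_lt a.2, add_zero]
    rw [if_neg hne, ite_self]

/-- **`(I_n; 0, …, 0) ∈ Z(I(im g_c))` for `n ≤ c·t` and EVERY `r`** (every infinite field): all `t` slots are free and
carry `I_n = Σ_k E_kᵀ E_k` (§1 with `F = {0, …, t−1}`).
[cite: BlaserIkenmeyerJindalLysikov2018, Obs. 17 ("The closure of the image of g is C^{n,t,c}_r" — examined)] -/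
theorem eval_eq_zero_one_zero [Infinite K] {n t c r : ℕ} (hct : n ≤ c * t)
    {p : MvPolynomial (Option (Fin t) × Fin n × Fin n) K} (hp : p ∈ lemma16VanishingIdeal K n t c r) :
    eval (tensorPoint K (1 : Matrix (Fin n) (Fin n) K) (fun _ : Fin t => (0 : Matrix (Fin n) (Fin n) K))) p = 0 := by
  classical
  obtain ⟨E, hE⟩ := exists_sum_transpose_mul_eq_one K (t := t) hct
  exact eval_eq_zero_of_free_slices K (r := r) 1 (fun _ => 0) E E Finset.univ
    (fun k hk => absurd (Finset.mem_univ k) hk) (fun _ _ => rfl) hE hp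

/-- **`C^{n,t,c}_r` is NOT the zero set of any set of polynomials whenever `r < n ≤ c·t`** (every infinite field,
algebraically closed ones included): such a set would vanish on `im g_c`, hence (§1) at `(I_n; 0, …, 0)`, which has
border completion rank `n > r`. Correction, for all these parameters at once, to "The closure of the image of `g` is
`C^{n,t,c}_r`" under Def. 9's rank-restricted approximations. [cite: BlaserIkenmeyerJindalLysikov2018, Obs. 17 (ECCC p. 12)] -/
theorem not_exists_equations_of_lt [Infinite K] {n t c r : ℕ} (hr : r < n) (hct : n ≤ c * t) :
    ¬ ∃ S : Set (MvPolynomial (Option (Fin t) × Fin n × Fin n) K),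
      {A | ∀ q ∈ S, eval (tensorPoint K A.1 A.2) q = 0} = bijlVariety K n t c r := by
  classical
  rintro ⟨S, hS⟩
  apply one_zero_not_mem_bijlVariety K (t := t) (c := c) hr
  rw [← hS]
  intro q hq
  have hvan : q ∈ lemma16VanishingIdeal K n t c r := by
    intro U₀ V₀ U V z
    have hmem := lemma16Map_mem_bijlVariety (K := K) (n := n) (t := t) (c := c) (r := r) U₀ V₀ U V z
    rw [← hS] at hmem
    exact hmem q hq
  exact eval_eq_zero_one_zero K hct hvan

/-- **The typed `∀ n`-hypothesis of `BIJL2018_thm4_strengthened` is unsatisfiable** for every parameter choice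
`(t, r, c)` that admits one `n` with `r n < n ≤ c · t n` — the regime of every instance family in which some tensor has
border completion rank above the threshold while `I_n` still decomposes into `t n` rank-`c` pieces.
[cite: BlaserIkenmeyerJindalLysikov2018, §3 remark after Obs. 17 (ECCC p. 12) — typed form examined] -/
theorem hypothesis_unsatisfiable [Infinite K] (t r : ℕ → ℕ) (c : ℕ) {n : ℕ} (hr : r n < n) (hct : n ≤ c * t n) :
    ¬ ∃ S : ∀ n : ℕ, Set (MvPolynomial (Option (Fin (t n)) × Fin n × Fin n) K),
      ∀ n, {A | ∀ p ∈ S n, eval (tensorPoint K A.1 A.2) p = 0} = bijlVariety K n (t n) c (r n) := by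
  rintro ⟨S, hS⟩
  exact not_exists_equations_of_lt K hr hct ⟨S n, hS n⟩

/-- In particular for the witnesses of the genuine discharge `BIJL2018_thm4_strengthened_holds` — `t n = n + 1`,
`r n = 13 ⌊n/20⌋`, `c = 20 (B + 1)` — the hypothesis fails at EVERY `n ≥ 1` (not only at `n = 1`, §2–§3).
[cite: BlaserIkenmeyerJindalLysikov2018, §3 remark after Obs. 17 (ECCC p. 12) — typed form examined] -/
theorem not_exists_equations_tSeq_rSeq [Infinite K] (B : ℕ) {n : ℕ} (hn : 1 ≤ n) :
    ¬ ∃ S : Set (MvPolynomial (Option (Fin (tSeq n)) × Fin n × Fin n) K),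
      {A | ∀ q ∈ S, eval (tensorPoint K A.1 A.2) q = 0} = bijlVariety K n (tSeq n) (cOf B) (rSeq n) :=
  not_exists_equations_of_lt K (by unfold rSeq; omega)
    ((Nat.le_succ n).trans (Nat.le_mul_of_pos_left (tSeq n) (by unfold cOf; omega)))

end BIJL2018Thm4S

/-! ### §5. The ruling-named certificate -/

/-- VACUITY CERTIFICATE — the typed Prop is inhabited for the wrong reason; the genuine proof is
`BIJL2018_thm4_strengthened_holds` (p530229).
For the parameter shape of that discharge (`t n = n + 1`, `r n = 13 ⌊n/20⌋`, `c = 20 (B + 1)`, any `B`) the typed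
hypothesis of `BIJL2018_thm4_strengthened` is unsatisfiable: NO family `S` has "zero set of `S n` = `C^{n,t n,c}_{r n}` for
every `n`" (it already fails at each single `n ≥ 1`, `BIJL2018Thm4S.not_exists_equations_tSeq_rSeq`; here via `n = 1`), so the
`∀ S`-conclusion ranges over the EMPTY family and the inhabitant-by-vacuity is
`BIJL2018Thm4S.BIJL2018_thm4_strengthened_of_degenerate_witnesses`. DO NOT CONSUME `BIJL2018_thm4_strengthened` as
mathematics; a faithful non-vacuous typing of the printed remark is not available in print (see the module docstring).
[cite: BlaserIkenmeyerJindalLysikov2018, §3 remark after Obs. 17 (ECCC p. 12) — typed form examined] -/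
theorem BIJL2018_thm4_strengthened_vacuous (K : Type u) [Field K] [Infinite K] (B : ℕ) :
    ¬ ∃ S : ∀ n : ℕ, Set (MvPolynomial (Option (Fin (BIJL2018Thm4S.tSeq n)) × Fin n × Fin n) K),
      ∀ n, {A | ∀ p ∈ S n, eval (tensorPoint K A.1 A.2) p = 0} =
        bijlVariety K n (BIJL2018Thm4S.tSeq n) (BIJL2018Thm4S.cOf B) (BIJL2018Thm4S.rSeq n) := by
  rintro ⟨S, hS⟩
  exact BIJL2018Thm4S.not_exists_equations_tSeq_rSeq K B (n := 1) le_rfl ⟨S 1, hS 1⟩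

end Literature.Barriers.ValiantsHypothesis

end
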